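import Summits.BirchSwinnertonDyer.BirchSwinnertonDyer.Theorems.ThetaPartnerAtTwoSignedControlAtTwoSignedCoinvChase
import Summits.BirchSwinnertonDyer.BirchSwinnertonDyer.Theorems.ByReductionTypeAtTwoSupersingularFlatDivAmbient
import HarnessLib

/-!
# KIM⁺@2 / COINV⁺ for Kobayashi's `Sel^ε(E/K_∞)` from Greenberg's p. 119 argument run inside an AMBIENT group
# `H ⊇ Sel^ε_∞` (in print `H = H¹(K_Σ/K_∞, E[p^∞])`): (a) the dual of `H` has no nonzero finite `Λ`-submodule
# ∧ (b) `H_Γ` finite ⇒ «DIV in `H`»; «DIV in `H`» ∧ «LIFT′ on `H`» ⇒ `(Sel^ε_∞)_γ = 0` ⇒ `X^ε` has no nonzero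
# finite `Λ`-submodule (B. D. Kim 2013 Thm. 1.1's shape, the registered stub `stub_plusKimNoFiniteSubmoduleTwo`)

Route `ThetaPartnerAtTwo` (TP2; crux shared with `ResidualThetaTransportAtTwo`), crux K4 `SignedControlAtTwo`
(stmt-BirchSwinnertonDyer-20309), line `eulerchar` v4 (skeleton sha16 1933daf127d03c20), stub
`stub_plusKimNoFiniteSubmoduleTwo` (KIM⁺@2: for every cyclotomic datum `(κ, γ)` and Pontryagin-dual datum `D` of
`Sel⁺(E/ℚ_∞)`, `X⁺ = D.X` `Λ`-torsion ⇒ no nonzero finite `Λ`-submodule). Seat `prover-bsd-wall-tp2-p3-w2`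
(width seat 2/3 of the line). Part 1 of the KIM⁺ series — the `±` twin of the ♭ road's part 4
(`…SupersingularFlatDivAmbient`, `bsd-2adic-ss-1` GEN 12; its generic §1 is imported and cited by name, its
`Sel^•`-specific chase is re-run here for `Sel^ε`).

WHY AN AMBIENT GROUP. Greenberg (LNM 1716, Lemma 4.7 / Prop. 4.8 and p. 119) runs the diagram inside
`H = H¹(F_Σ/F_∞, E[p^∞])` and proves `H_Γ = 0` from TWO properties of the Pontryagin dual `Y` of `H`:
(a) `Y` has no nonzero finite `Λ`-submodule («no proper `Λ`-submodule of finite index», Prop. 4.12 under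
`Λ`-corank `[F:ℚ]` — at a SUPERSINGULAR `p` the corank hypothesis is Kato's Thm. 12.4, PRINT BY NAME
`Greenberg1999.prop412_noFiniteSubmodule_H1Sigma_of_rank_one` ∘ `Greenberg1999.h1SigmaInfty_rank_eq_one`) and
(b) `H_Γ` finite (p. 119: «it is enough to prove that `H¹(F_Σ/F_∞, E[p^∞])_Γ` is finite»). B. D. Kim
(J. Aust. Math. Soc. 95 (2013), Thm. 3.14) follows the same road for `Sel^±` at odd `p`.

WHAT IS PROVED (namespace `…Theorems.SignedEC`; any number field `K`, prime `p`, `ℤ_p`-extension `κ`, sign `ε`,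
topological generator `γ`):
* §1 **(a) ∧ (b) ⇒ «DIV in `H`»** is the ♭ road's generic theorem `SSFlatEC.forall_exists_conjH1_sub_eq_of_noFinite_of_finite`
  (imported): for a `conj_γ`-stable `H ≤ H¹(K_∞, E[p^∞])` with a Pontryagin-dual datum `(Y, dY)` such that `Y` has no
  nonzero finite `Λ`-submodule and `Y[T]` is finite, every `s ∈ H` is `conj_γ t − t` for some `t ∈ H`.
* §2 `signedEndCoinvariants_subsingleton_of_ambient` — **the chase inside `H ⊇ Sel^ε_∞`** with «LIFT′» in its
  weakest form «every `t ∈ H` with `conj_γ t − t ∈ Sel^ε_∞` is congruent mod `Sel^ε_∞` to a `conj_γ`-INVARIANT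
  class»: «DIV in `H`» ∧ «LIFT′ on `H`» ⇒ `(Sel^ε_∞)_γ = 0`; `…_of_ambient_noFinite`: (a) ∧ (b) ∧ «LIFT′» ⇒ the same;
  `signed_lift'_of_lift`: the restricted-class form `t − h_0 y ∈ Sel^ε_∞` implies «LIFT′».
* §3 `signed_forall_noFiniteSubmodule_of_ambient_noFinite` — **KIM's shape**: (a) ∧ (b) ∧ «LIFT′» ⇒ for EVERY
  Pontryagin-dual datum `D` of `Sel^ε(E/K_∞)`, `D.X` has no nonzero finite `Λ`-submodule (through the landed
  `signed_forall_finite_eq_bot_of_endCoinvariants_subsingleton`, p570923); and at `p = 2`, `ε = 1`, the body of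
  the registered stub for one curve and one cyclotomic datum: `plusKimTwo_of_ambient_noFinite`.
So after this file KIM⁺@2 reads: PRINT {Prop. 4.12 + `Λ`-corank 1 for `H¹(ℚ_Σ/ℚ_∞, E[2^∞])`} + (b) «`H_Γ` finite»
(p. 119's corank count from `Sel_{2^∞}(E/ℚ)` finite) + «LIFT′ on `H`» (Cassels' theorem + the local `Γ`-lifts at
`Σ₀`, at `2` — the `±` local theory LOC⁺@2 — and at `∞`; the sequel files). HONEST FRAMING: THEOREMS ONLY (no
definition, no named fact, no `sorry`), route-independent; (a), (b) and «LIFT′» are displayed hypotheses, NOT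
proved here; nothing about any curve is asserted; closes no item by itself; BSD is not proved by any of this.

References: [GreenbergLNM1716] §1 p. 60, §4 p. 104, Lemma 4.7 / Prop. 4.8 (pp. 107–109), Prop. 4.12 and p. 119;
[BDKim2013] Thm. 1.1, Thm. 3.14; [Kobayashi2003] Def. 1.1.
-/

set_option autoImplicit false
-- the Theorems namespace of this sub repeats the summit name by design (D-0017 nested layout)
set_option linter.dupNamespace false

noncomputable section

open scoped Classical NumberField

open NumberField IsDedekindDomain

universe u

namespace Summit.BirchSwinnertonDyer.BirchSwinnertonDyer.Theorems.SignedEC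

open Literature.NumberTheory.EllipticCurves Literature.NumberTheory.GaloisRepresentations
  WeierstrassCurve ZpExtension Literature.NumberTheory.EllipticCurves.Kobayashi2003
  Literature.NumberTheory.EllipticCurves.IwasawaDual Literature.NumberTheory.EllipticCurves.IwasawaAlgebra

/-! ## §1 (a) no finite submodule ∧ (b) `Y[T]` finite ⇒ «DIV in `H`» — this is the ♭ road's GENERIC theorem
`SSFlatEC.forall_exists_conjH1_sub_eq_of_noFinite_of_finite` (file `…SupersingularFlatDivAmbient`, `bsd-2adic-ss-1`
GEN 12), imported and used by name below (no copy). -/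

/-! ## §2 The chase inside an ambient `H ⊇ Sel^ε_∞`, with «LIFT′» (invariant classes) -/

section Chase

variable {K : Type u} [Field K] [NumberField K] (W : WeierstrassCurve K) {p : ℕ} [Fact p.Prime]
  (κ : ZpExtension K p) (ε : ℤˣ) (γ : Field.absoluteGaloisGroup K)

/-- **Greenberg's chase inside an ambient group, for Kobayashi's `Sel^ε(E/K_∞)`.** Let `H ≤ H¹(K_∞, E[p^∞])`
(any subgroup; in the source `H = H¹(F_Σ/F_∞, E[p^∞])`). If «DIV in `H`»: every `s ∈ Sel^ε_∞` is `conj_γ t − t`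
for some `t ∈ H`, and «LIFT′ on `H`»: every `t ∈ H` with `conj_γ t − t ∈ Sel^ε_∞` is congruent modulo `Sel^ε_∞` to
a `conj_γ`-invariant class `t₀` (Greenberg: `𝒫^Σ(F) ↠ 𝒫^Σ(F_∞)^Γ` and Cassels, pp. 107–108 — the restriction of
a class over `F` is one such `t₀`), then `(Sel^ε(E/K_∞))_γ = 0`: `t' = t − t₀ ∈ Sel^ε_∞` and `conj_γ t' − t' = s`.
[cite: GreenbergLNM1716, §4 Lemma 4.7 (pp. 107–108) and Prop. 4.8 (p. 109)] [cite: BDKim2013, Thm. 3.14] -/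
theorem signedEndCoinvariants_subsingleton_of_ambient (Hs : AddSubgroup (W.subgroupH1 p κ.kerSubgroup))
    (hdiv : ∀ s : W.subgroupH1 p κ.kerSubgroup, s ∈ signedSelmerInfty W κ ε →
      ∃ t ∈ Hs, W.conjH1 p κ.kerSubgroup γ t - t = s)
    (hlift : ∀ t ∈ Hs, W.conjH1 p κ.kerSubgroup γ t - t ∈ signedSelmerInfty W κ ε →
      ∃ t₀ : W.subgroupH1 p κ.kerSubgroup, W.conjH1 p κ.kerSubgroup γ t₀ = t₀ ∧
        t - t₀ ∈ signedSelmerInfty W κ ε) :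
    Subsingleton (EndCoinvariants (conjSignedSelmerInfty W κ ε γ - 1)) := by
  refine subsingleton_of_forall_eq 0 fun q ↦ ?_
  induction q using QuotientAddGroup.induction_on with
  | H s =>
    obtain ⟨t, htH, ht⟩ := hdiv s s.2
    have htS : W.conjH1 p κ.kerSubgroup γ t - t ∈ signedSelmerInfty W κ ε := by
      rw [ht]; exact s.2
    obtain ⟨t₀, hinv, hy⟩ := hlift t htH htS
    refine (endCoinvariants_mk_eq_zero_iff _ s).mpr ⟨⟨t - t₀, hy⟩, ?_⟩
    apply Subtype.ext
    rw [End_sub_apply, AddMonoid.End.one_apply, AddSubgroupClass.coe_sub, coe_conjSignedSelmerInfty_apply]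
    change W.conjH1 p κ.kerSubgroup γ (t - t₀) - (t - t₀) = (s : _)
    rw [map_sub, hinv, ← ht]
    abel

/-- «LIFT» in the restricted-class form (`t − h_0 y ∈ Sel^ε_∞`, `y ∈ H¹(K, E[p^∞])`) implies «LIFT′» (an
invariant class): `h_0 y` is `Γ_K`-invariant (`range_layerToInfty_le_layerInvariants_holds`).
[cite: GreenbergLNM1716, §4 Lemma 4.7 (pp. 107–108)] -/
theorem signed_lift'_of_lift (Hs : AddSubgroup (W.subgroupH1 p κ.kerSubgroup))
    (hlift : ∀ t ∈ Hs, W.conjH1 p κ.kerSubgroup γ t - t ∈ signedSelmerInfty W κ ε →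
      ∃ y : W.subgroupH1 p (κ.layerSubgroup 0), t - W.layerToInfty κ 0 y ∈ signedSelmerInfty W κ ε) :
    ∀ t ∈ Hs, W.conjH1 p κ.kerSubgroup γ t - t ∈ signedSelmerInfty W κ ε →
      ∃ t₀ : W.subgroupH1 p κ.kerSubgroup, W.conjH1 p κ.kerSubgroup γ t₀ = t₀ ∧
        t - t₀ ∈ signedSelmerInfty W κ ε := by
  intro t ht hts
  obtain ⟨y, hy⟩ := hlift t ht hts
  refine ⟨W.layerToInfty κ 0 y, ?_, hy⟩
  have hmem := W.range_layerToInfty_le_layerInvariants_holds κ 0 ⟨y, rfl⟩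
  rw [W.mem_layerInvariants_iff κ 0] at hmem
  exact hmem γ (by rw [ZpExtension.layerSubgroup_zero]; trivial)

/-- **(a) ∧ (b) for an ambient `conj_γ`-stable `H ⊇ Sel^ε_∞` ∧ «LIFT′ on `H`» ⇒ `(Sel^ε(E/K_∞))_γ = 0`**
(§1 + the chase; `γ` a topological generator). [cite: GreenbergLNM1716, §4 Prop. 4.8 (p. 109) and p. 119] -/
theorem signedEndCoinvariants_subsingleton_of_ambient_noFinite (hγ : κ.IsTopGenerator γ)
    (Hs : AddSubgroup (W.subgroupH1 p κ.kerSubgroup)) (hH : ∀ x ∈ Hs, W.conjH1 p κ.kerSubgroup γ x ∈ Hs)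
    (hle : signedSelmerInfty W κ ε ≤ Hs)
    {Y : Type*} [AddCommGroup Y] [Module (IwasawaAlgebra p) Y] (dY : Y →+ (Hs →+ AddCircle (1 : ℚ)))
    (hbij : Function.Bijective dY)
    (hT : ∀ (y : Y) (x : Hs), dY ((PowerSeries.X : IwasawaAlgebra p) • y) x =
      dY y ⟨W.conjH1 p κ.kerSubgroup γ x, hH x x.2⟩ - dY y x)
    (hC : ∀ (a : ℤ_[p]) (y : Y) (x : Hs) (k : ℕ), (p ^ k) • x = 0 →
      dY (PowerSeries.C a • y) x = (PadicInt.toZModPow k a).val • dY y x)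
    (hY : ∀ N : Submodule (IwasawaAlgebra p) Y, Finite N → N = ⊥)
    (hfin : Finite (invariants p Y))
    (hlift : ∀ t ∈ Hs, W.conjH1 p κ.kerSubgroup γ t - t ∈ signedSelmerInfty W κ ε →
      ∃ t₀ : W.subgroupH1 p κ.kerSubgroup, W.conjH1 p κ.kerSubgroup γ t₀ = t₀ ∧
        t - t₀ ∈ signedSelmerInfty W κ ε) :
    Subsingleton (EndCoinvariants (conjSignedSelmerInfty W κ ε γ - 1)) :=
  signedEndCoinvariants_subsingleton_of_ambient W κ ε γ Hs
    (fun s hs ↦ SSFlatEC.forall_exists_conjH1_sub_eq_of_noFinite_of_finite W κ hγ Hs hH dY hbij hT hC hY hfin s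
      (hle hs)) hlift

end Chase

/-! ## §3 KIM's shape: no nonzero finite `Λ`-submodule in `X^ε`, for every Pontryagin-dual datum -/

section Kim

variable {K : Type u} [Field K] [NumberField K] (W : WeierstrassCurve K) {p : ℕ} [Fact p.Prime]
  (κ : ZpExtension K p) (ε : ℤˣ) {γ : Field.absoluteGaloisGroup K}

/-- **B. D. Kim's Thm. 1.1 / 3.14 shape from the ambient road**: (a) ∧ (b) for an ambient `conj_γ`-stable
`H ⊇ Sel^ε(E/K_∞)` ∧ «LIFT′ on `H`» ⇒ for EVERY Pontryagin-dual datum `D` of `Sel^ε(E/K_∞)` (w.r.t. the topological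
generator `γ`), `X^ε = D.X` has no nonzero finite `Λ`-submodule — `(Sel^ε_∞)_γ = 0` (§2), then `X[T] ≅ Hom((Sel^ε_∞)_γ, ℚ/ℤ) = 0`
and a nonzero finite submodule would meet `X[T]` (landed `signed_forall_finite_eq_bot_of_endCoinvariants_subsingleton`).
Any number field, prime, `ℤ_p`-extension and sign; no torsion hypothesis on `X^ε` is needed on this road.
[cite: BDKim2013, Thm. 1.1 and Thm. 3.14] [cite: GreenbergLNM1716, §4 p. 104, Prop. 4.8, p. 119] -/
theorem signed_forall_noFiniteSubmodule_of_ambient_noFinite (hγ : κ.IsTopGenerator γ)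
    (Hs : AddSubgroup (W.subgroupH1 p κ.kerSubgroup)) (hH : ∀ x ∈ Hs, W.conjH1 p κ.kerSubgroup γ x ∈ Hs)
    (hle : signedSelmerInfty W κ ε ≤ Hs)
    {Y : Type*} [AddCommGroup Y] [Module (IwasawaAlgebra p) Y] (dY : Y →+ (Hs →+ AddCircle (1 : ℚ)))
    (hbij : Function.Bijective dY)
    (hT : ∀ (y : Y) (x : Hs), dY ((PowerSeries.X : IwasawaAlgebra p) • y) x =
      dY y ⟨W.conjH1 p κ.kerSubgroup γ x, hH x x.2⟩ - dY y x)
    (hC : ∀ (a : ℤ_[p]) (y : Y) (x : Hs) (k : ℕ), (p ^ k) • x = 0 →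
      dY (PowerSeries.C a • y) x = (PadicInt.toZModPow k a).val • dY y x)
    (hY : ∀ N : Submodule (IwasawaAlgebra p) Y, Finite N → N = ⊥)
    (hfin : Finite (invariants p Y))
    (hlift : ∀ t ∈ Hs, W.conjH1 p κ.kerSubgroup γ t - t ∈ signedSelmerInfty W κ ε →
      ∃ t₀ : W.subgroupH1 p κ.kerSubgroup, W.conjH1 p κ.kerSubgroup γ t₀ = t₀ ∧
        t - t₀ ∈ signedSelmerInfty W κ ε)
    (D : SignedSelmerDualData W κ γ ε) :
    ∀ N : Submodule (IwasawaAlgebra p) D.X, Finite N → N = ⊥ := by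
  haveI := signedEndCoinvariants_subsingleton_of_ambient_noFinite W κ ε γ hγ Hs hH hle dY hbij hT hC hY hfin
    hlift
  exact signed_forall_finite_eq_bot_of_endCoinvariants_subsingleton D hγ

/-- **«DIV in `H`» ∧ «LIFT′ on `H`» ⇒ KIM's shape**, the two displayed inputs kept abstract (no dual datum of `H`
mentioned): for every Pontryagin-dual datum `D` of `Sel^ε(E/K_∞)`, `D.X` has no nonzero finite `Λ`-submodule.
[cite: BDKim2013, Thm. 1.1 and Thm. 3.14] [cite: GreenbergLNM1716, §4 Lemma 4.7, Prop. 4.8] -/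
theorem signed_forall_noFiniteSubmodule_of_div_of_lift' (hγ : κ.IsTopGenerator γ)
    (Hs : AddSubgroup (W.subgroupH1 p κ.kerSubgroup))
    (hdiv : ∀ s : W.subgroupH1 p κ.kerSubgroup, s ∈ signedSelmerInfty W κ ε →
      ∃ t ∈ Hs, W.conjH1 p κ.kerSubgroup γ t - t = s)
    (hlift : ∀ t ∈ Hs, W.conjH1 p κ.kerSubgroup γ t - t ∈ signedSelmerInfty W κ ε →
      ∃ t₀ : W.subgroupH1 p κ.kerSubgroup, W.conjH1 p κ.kerSubgroup γ t₀ = t₀ ∧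
        t - t₀ ∈ signedSelmerInfty W κ ε)
    (D : SignedSelmerDualData W κ γ ε) :
    ∀ N : Submodule (IwasawaAlgebra p) D.X, Finite N → N = ⊥ := by
  haveI := signedEndCoinvariants_subsingleton_of_ambient W κ ε γ Hs hdiv hlift
  exact signed_forall_finite_eq_bot_of_endCoinvariants_subsingleton D hγ

end Kim

/-! ## §4 `p = 2`, `ε = 1`: the registered stub's body for one curve and one cyclotomic datum -/

section Two

variable (W : WeierstrassCurve ℚ) (κ : ZpExtension ℚ 2) {γ : Field.absoluteGaloisGroup ℚ}

/-- **KIM⁺@2 for one curve and one datum `(κ, γ)` from the ambient road.** For `W/ℚ` (any Weierstrass curve — the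
habitat prefix `¬CM`, `r_an = 0`, `GoodSS 2`, `a₂ = 0` of the registered stub `stub_plusKimNoFiniteSubmoduleTwo` is
not needed for this step), a `ℤ₂`-extension `κ` with topological generator `γ`: given an ambient `conj_γ`-stable
`H ⊇ Sel⁺(E/ℚ_∞)` in `H¹(ℚ_∞, E[2^∞])` whose Pontryagin dual has (a) no nonzero finite `Λ₂`-submodule and (b) finite
`Y[T]`, and «LIFT′ on `H`», the conclusion of the stub holds for EVERY dual datum `D` (its premises `Module.Finite`,
`Module.IsTorsion` unused). In print `H = H¹(ℚ_Σ/ℚ_∞, E[2^∞])`, (a) = Prop. 4.12 ∘ Kato Thm. 12.4, (b) = p. 119,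
«LIFT′» = Cassels + local `Γ`-lifts (LOC⁺@2 at the place above `2`).
[cite: BDKim2013, Thm. 1.1] [cite: GreenbergLNM1716, §4 Prop. 4.12, p. 119, Lemma 4.7] -/
theorem plusKimTwo_of_ambient_noFinite (hγ : κ.IsTopGenerator γ)
    (Hs : AddSubgroup (W.subgroupH1 2 κ.kerSubgroup)) (hH : ∀ x ∈ Hs, W.conjH1 2 κ.kerSubgroup γ x ∈ Hs)
    (hle : signedSelmerInfty W κ 1 ≤ Hs)
    {Y : Type} [AddCommGroup Y] [Module (IwasawaAlgebra 2) Y] (dY : Y →+ (Hs →+ AddCircle (1 : ℚ)))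
    (hbij : Function.Bijective dY)
    (hT : ∀ (y : Y) (x : Hs), dY ((PowerSeries.X : IwasawaAlgebra 2) • y) x =
      dY y ⟨W.conjH1 2 κ.kerSubgroup γ x, hH x x.2⟩ - dY y x)
    (hC : ∀ (a : ℤ_[2]) (y : Y) (x : Hs) (k : ℕ), (2 ^ k) • x = 0 →
      dY (PowerSeries.C a • y) x = (PadicInt.toZModPow k a).val • dY y x)
    (hY : ∀ N : Submodule (IwasawaAlgebra 2) Y, Finite N → N = ⊥)
    (hfin : Finite (invariants 2 Y))
    (hlift : ∀ t ∈ Hs, W.conjH1 2 κ.kerSubgroup γ t - t ∈ signedSelmerInfty W κ 1 →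
      ∃ t₀ : W.subgroupH1 2 κ.kerSubgroup, W.conjH1 2 κ.kerSubgroup γ t₀ = t₀ ∧
        t - t₀ ∈ signedSelmerInfty W κ 1) :
    ∀ (D : SignedSelmerDualData W κ γ 1) [Module.Finite (IwasawaAlgebra 2) D.X],
      Module.IsTorsion (IwasawaAlgebra 2) D.X →
      ∀ N : Submodule (IwasawaAlgebra 2) D.X, Finite N → N = ⊥ :=
  fun D _ _ ↦ signed_forall_noFiniteSubmodule_of_ambient_noFinite W κ 1 hγ Hs hH hle dY hbij hT hC hY hfin hlift D

end Two

end Summit.BirchSwinnertonDyer.BirchSwinnertonDyer.Theorems.SignedEC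

end
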